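import Summits.MatrixMultiplication.OmegaCensus.DihC3SqModel

/-!
# ω-census, family (b3): the class `𝒞₂` — certificate checkers for the fibre model

HONEST FRAMING (pub-omega census; verbatim): lottery ticket; floor = certified bounds/negative ranges.
Census BOOKKEEPING (prereg P-031 of the cell, item .3, session A); group-free; nothing here is progress on `ω`.

CHECKERS (all facts about concrete configurations are then kernel computations, see `DihC3SqModelCert*`):
* `NoIndepK adj cand k` — no `adj`-independent `k`-set inside the mask `cand`; from the tree checker `IndepSearch.noIndep`
  (`noIndepK_of_chunk`), composed along explicit split trees (`NoIndepK.split`) and over the TRANSLATION-AWARE ROOT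
  (`noIndepK_root`: the lift translations `λ ↦ λ + s` are automorphisms of every model graph, `testBit_adjRow_transl`, so an
  independent `17`-set may be assumed to contain the vertex `(p_j, 0)` of its first position `p_j`).
* `wcOK` — a WEIGHTED CLIQUE COVER (cliques `C_i` as vertex lists with weights `w_i`, every vertex covered with weight `≥ M`,
  `Σ w_i < 17 M`) certifies "no independent `17`-set" (`noIndepK_of_wcOK`; double counting, an independent set meets a clique once).
* `lf` / `NoIndepK.leaf` — the leaf form used by the certificate files `DihC3SqCert*`.
-/

open Finset

namespace Summit.MatrixMultiplication.OmegaCensus.DihC3Sq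

open CentreIndexSix IndepSearch

/-! ## `NoIndepK`: no independent `k`-set inside a mask -/

/-- No `adj`-independent set of `k` vertices `< 81` inside the mask `cand`. [folklore] -/
def NoIndepK (adj : ℕ → ℕ) (cand k : ℕ) : Prop :=
  ∀ I : Finset ℕ, IndepN adj I → (∀ a ∈ I, a < 81 ∧ cand.testBit a = true) → #I < k

/-- `Bound16 n`: the model graph of configuration `n` has no independent `17`-set. [folklore] -/
def Bound16 (n : ℕ) : Prop := NoIndepK (adjRow (packAdj n)) (2 ^ 81 - 1) 17

/-- `Bound16` in the form used by the reduction: independent vertex sets have at most `16` elements. [folklore] -/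
theorem Bound16.card_le {n : ℕ} (h : Bound16 n) (I : Finset ℕ) (hI : IndepN (adjRow (packAdj n)) I)
    (hIn : ∀ a ∈ I, a < 81) : #I ≤ 16 := by
  have := h I hI fun a ha => ⟨hIn a ha, by rw [Nat.testBit_two_pow_sub_one]; simpa using hIn a ha⟩
  omega

/-- The vertex order used by the searches (position-major). [folklore] -/
def vsOrder : List ℕ := List.range 81

/-- **Leaf soundness.** A `true` answer of the tree checker over `vsOrder`. [folklore] -/
theorem noIndepK_of_noIndep {A cand k : ℕ} (h : noIndep (adjRow A) vsOrder cand k = true) : NoIndepK (adjRow A) cand k :=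
  fun I hI hsub => card_lt_of_noIndep _ vsOrder cand k h I hI fun a ha =>
    ⟨by rw [vsOrder, List.mem_range]; exact (hsub a ha).1, (hsub a ha).2⟩

/-- Leaf check shorthand of the certificate files: the tree checker over `vsOrder` on the mask `c` with bound `k`. [folklore] -/
def lf (A c k : ℕ) : Bool := noIndep (adjRow A) vsOrder c k

/-- **Leaf soundness**, shorthand form. [folklore] -/
theorem NoIndepK.leaf {A c k : ℕ} (h : lf A c k = true) : NoIndepK (adjRow A) c k := noIndepK_of_noIndep h

/-- The "vertex in" child mask of a split at `v`. [folklore] -/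
def sIn (A c v : ℕ) : ℕ := (c.ldiff (adjRow A v)).ldiff (2 ^ v)

/-- The "vertex out" child mask of a split at `v`. [folklore] -/
def sOut (c v : ℕ) : ℕ := c.ldiff (2 ^ v)

/-- **Split.** Branching on a vertex `v`: if no `k`-set lies among the candidates other than `v` and its flagged neighbours,
and no `(k+1)`-set among the candidates other than `v`, then no `(k+1)`-set lies among the candidates. [folklore] -/
theorem NoIndepK.split {A cand k : ℕ} (v : ℕ) (hin : NoIndepK (adjRow A) (sIn A cand v) k)
    (hout : NoIndepK (adjRow A) (sOut cand v) (k + 1)) : NoIndepK (adjRow A) cand (k + 1) := by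
  classical
  intro I hI hsub
  by_cases hv : v ∈ I
  · have h := hin (I.erase v) (fun a ha b hb hab => hI a (mem_of_mem_erase ha) b (mem_of_mem_erase hb) hab) fun a ha => by
      have hav : a ≠ v := ne_of_mem_erase ha
      have haI := mem_of_mem_erase ha
      refine ⟨(hsub a haI).1, ?_⟩
      rw [sIn, Nat.testBit_ldiff, Nat.testBit_ldiff, (hsub a haI).2, hI v hv a haI (Ne.symm hav), Nat.testBit_two_pow]
      simp [Ne.symm hav]
    have := card_erase_add_one hv
    omega
  · exact hout I hI fun a ha => ⟨(hsub a ha).1, by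
      rw [sOut, Nat.testBit_ldiff, (hsub a ha).2, Nat.testBit_two_pow]
      have : v ≠ a := fun e => hv (e ▸ ha)
      simp [this]⟩

/-- Monotonicity in the mask. [folklore] -/
theorem NoIndepK.mono {adj : ℕ → ℕ} {cand cand' k : ℕ} (h : NoIndepK adj cand k)
    (hle : ∀ a, cand'.testBit a = true → cand.testBit a = true) : NoIndepK adj cand' k :=
  fun I hI hsub => h I hI fun a ha => ⟨(hsub a ha).1, hle a (hsub a ha).2⟩

/-! ### The translation-aware root -/

/-- Candidates of the `j`-th root branch: the vertices at positions `≥ j` other than `v_j = 9 j` and its flagged neighbours.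
[folklore] -/
def candJ (A j : ℕ) : ℕ := ((((2 ^ 81 - 1).ldiff (2 ^ (9 * j) - 1)).ldiff (adjRow A (9 * j))).ldiff (2 ^ (9 * j)))

/-- Bits of `candJ`. [folklore] -/
theorem testBit_candJ (A j a : ℕ) : (candJ A j).testBit a = true ↔
    a < 81 ∧ 9 * j ≤ a ∧ (adjRow A (9 * j)).testBit a = false ∧ a ≠ 9 * j := by
  rw [candJ, Nat.testBit_ldiff, Nat.testBit_ldiff, Nat.testBit_ldiff, Nat.testBit_two_pow, Nat.testBit_two_pow_sub_one,
    Nat.testBit_two_pow_sub_one]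
  constructor
  · intro h
    simp only [Bool.and_eq_true, Bool.not_eq_true', decide_eq_true_eq, decide_eq_false_iff_not, not_lt] at h
    obtain ⟨⟨⟨h1, h2⟩, h3⟩, h4⟩ := h
    exact ⟨h1, h2, h3, fun e => h4 e.symm⟩
  · rintro ⟨h1, h2, h3, h4⟩
    simp [h1, h2, h3, Ne.symm h4]

/-- **Translation-aware root.** If for every position `j` no independent `16`-set lies in `candJ j`, then the graph has no
independent `17`-set at all: translate a putative `17`-set so that its vertex at its first position `p_j` becomes `(p_j, 0)`.
[folklore] -/
theorem noIndepK_root (n : ℕ) (h : ∀ j < 9, NoIndepK (adjRow (packAdj n)) (candJ (packAdj n) j) 16) :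
    NoIndepK (adjRow (packAdj n)) (2 ^ 81 - 1) 17 := by
  classical
  intro I hI hsub
  have hI81 : ∀ a ∈ I, a < 81 := fun a ha => (hsub a ha).1
  by_contra hge'
  have hge : 17 ≤ #I := not_lt.1 hge'
  have hne : I.Nonempty := by rw [← card_pos]; omega
  -- the first position of `I` and a vertex there
  obtain ⟨a0, ha0, hmin⟩ := exists_min_image I (fun a => a / 9) hne
  set j := a0 / 9 with hj
  have hj9 : j < 9 := by have := hI81 a0 ha0; omega
  -- the translation taking the lift of `a0` to `0`
  set s0 := (3 - a0 % 9 % 3) % 3 with hs0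
  set s1 := (3 - a0 % 9 / 3 % 3) % 3 with hs1
  have hs0' : s0 < 3 := Nat.mod_lt _ (by norm_num)
  have hs1' : s1 < 3 := Nat.mod_lt _ (by norm_num)
  have hτa0 : transl s0 s1 a0 = 9 * j := by
    simp only [transl, shiftIdx, hs0, hs1, hj]; omega
  -- translate `I`
  have hinj : Set.InjOn (transl s0 s1) I := by
    intro a ha b hb hab
    have h9 : a / 9 = b / 9 := by
      have h1 := shiftIdx_lt (a % 9) s0 s1; have h2 := shiftIdx_lt (b % 9) s0 s1
      simp only [transl] at hab; omega
    have hsh : shiftIdx (a % 9) s0 s1 = shiftIdx (b % 9) s0 s1 := by simp only [transl] at hab; omega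
    have := shiftIdx_inj _ (Nat.mod_lt a (by norm_num)) _ (Nat.mod_lt b (by norm_num)) s0 hs0' s1 hs1' hsh
    omega
  obtain ⟨hI', hcard⟩ := hI.image (transl s0 s1) hinj fun a _ b _ _ hab => by
    rwa [testBit_adjRow_transl n hs0' hs1'] at hab
  -- the translated set minus `(p_j, 0)` lies in `candJ j`
  have hmem : 9 * j ∈ I.image (transl s0 s1) := mem_image.2 ⟨a0, ha0, hτa0⟩
  have hlt := h j hj9 ((I.image (transl s0 s1)).erase (9 * j))
    (fun a ha b hb hab => hI' a (mem_of_mem_erase ha) b (mem_of_mem_erase hb) hab) fun b hb => by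
      have hbne : b ≠ 9 * j := ne_of_mem_erase hb
      have hb' := mem_of_mem_erase hb
      obtain ⟨a, ha, rfl⟩ := mem_image.1 hb'
      have h81 : transl s0 s1 a < 81 := by
        have := hI81 a ha; have := shiftIdx_lt (a % 9) s0 s1; simp only [transl]; omega
      rw [testBit_candJ]
      refine ⟨h81, h81, ?_, hI' _ hmem _ hb' (Ne.symm hbne), hbne⟩
      have := hmin a ha; simp only [transl]; omega
  have := card_erase_add_one hmem
  omega

/-- The root with its nine branches as separate hypotheses (the form the certificate files use). [folklore] -/
theorem bound16_of_branches (n : ℕ)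
    (h0 : NoIndepK (adjRow (packAdj n)) (candJ (packAdj n) 0) 16) (h1 : NoIndepK (adjRow (packAdj n)) (candJ (packAdj n) 1) 16)
    (h2 : NoIndepK (adjRow (packAdj n)) (candJ (packAdj n) 2) 16) (h3 : NoIndepK (adjRow (packAdj n)) (candJ (packAdj n) 3) 16)
    (h4 : NoIndepK (adjRow (packAdj n)) (candJ (packAdj n) 4) 16) (h5 : NoIndepK (adjRow (packAdj n)) (candJ (packAdj n) 5) 16)
    (h6 : NoIndepK (adjRow (packAdj n)) (candJ (packAdj n) 6) 16) (h7 : NoIndepK (adjRow (packAdj n)) (candJ (packAdj n) 7) 16)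
    (h8 : NoIndepK (adjRow (packAdj n)) (candJ (packAdj n) 8) 16) : Bound16 n := by
  refine noIndepK_root n fun j hj => ?_
  interval_cases j <;> assumption

/-! ## Weighted clique covers -/

/-- The listed vertices are pairwise flagged adjacent (in at least one order). [folklore] -/
def cliqueB (A : ℕ) : List ℕ → Bool
  | [] => true
  | a :: l => l.all (fun b => (adjRow A a).testBit b || (adjRow A b).testBit a) && cliqueB A l

/-- The total weight of the listed cliques containing `v`. [folklore] -/
def coverW (cert : List (List ℕ × ℕ)) (v : ℕ) : ℕ := (cert.map fun cw => if v ∈ cw.1 then cw.2 else 0).sum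

/-- **Weighted clique cover certificate** of configuration `n`: cliques `C_i` (vertex lists) with weights `w_i` such that every
vertex `< 81` is covered with total weight `≥ M` and `Σ w_i < 17 M`. [folklore] -/
def wcOK (n : ℕ) (cert : List (List ℕ × ℕ)) (M : ℕ) : Bool :=
  let A := packAdj n
  cert.all (fun cw => cliqueB A cw.1) && (List.range 81).all (fun v => decide (M ≤ coverW cert v)) &&
    decide ((cert.map (·.2)).sum < 17 * M)

/-- An independent set meets a `cliqueB` list in at most one vertex. [folklore] -/
theorem card_filter_mem_le_one {A : ℕ} {I : Finset ℕ} (hI : IndepN (adjRow A) I) :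
    ∀ C : List ℕ, cliqueB A C = true → #(I.filter (· ∈ C)) ≤ 1 := by
  classical
  intro C hC
  rw [card_le_one]
  intro a ha b hb
  rw [mem_filter] at ha hb
  by_contra hab
  -- extract the flagged adjacency of two distinct members of `C`
  have key : ∀ C : List ℕ, cliqueB A C = true → ∀ a ∈ C, ∀ b ∈ C, a ≠ b →
      (adjRow A a).testBit b = true ∨ (adjRow A b).testBit a = true := by
    intro C
    induction C with
    | nil => intro _ a ha; simp at ha
    | cons c l ih =>
        intro hc a ha b hb hne
        simp only [cliqueB, Bool.and_eq_true, List.all_eq_true, Bool.or_eq_true] at hc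
        rcases List.mem_cons.1 ha with rfl | ha' <;> rcases List.mem_cons.1 hb with rfl | hb'
        · exact absurd rfl hne
        · exact hc.1 b hb'
        · exact (hc.1 a ha').symm
        · exact ih hc.2 a ha' b hb' hne
  rcases key C hC a ha.2 b hb.2 hab with h | h
  · rw [hI a ha.1 b hb.1 hab] at h; exact Bool.false_ne_true h
  · rw [hI b hb.1 a ha.1 (Ne.symm hab)] at h; exact Bool.false_ne_true h

/-- Double counting: summing cover weights over `I` = summing `w_i · #(I ∩ C_i)` over the cliques. [folklore] -/
theorem sum_coverW (I : Finset ℕ) : ∀ cert : List (List ℕ × ℕ),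
    ∑ a ∈ I, coverW cert a = (cert.map fun cw => cw.2 * #(I.filter (· ∈ cw.1))).sum
  | [] => by simp [coverW]
  | cw :: cert => by
      classical
      have e : ∀ a, coverW (cw :: cert) a = (if a ∈ cw.1 then cw.2 else 0) + coverW cert a := by
        intro a; simp [coverW]
      simp only [e, sum_add_distrib, sum_coverW I cert, List.map_cons, List.sum_cons]
      congr 1
      rw [← sum_filter, sum_const, smul_eq_mul, mul_comm]

/-- **Soundness of weighted clique covers.** [folklore] -/
theorem bound16_of_wcOK {n : ℕ} {cert : List (List ℕ × ℕ)} {M : ℕ} (h : wcOK n cert M = true) : Bound16 n := by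
  classical
  intro I hI hsub
  simp only [wcOK, Bool.and_eq_true, List.all_eq_true, decide_eq_true_eq, List.mem_range] at h
  obtain ⟨⟨hcl, hcov⟩, hsum⟩ := h
  have hI81 : ∀ a ∈ I, a < 81 := fun a ha => (hsub a ha).1
  have h1 : M * #I ≤ ∑ a ∈ I, coverW cert a :=
    calc M * #I = ∑ _a ∈ I, M := by rw [sum_const, smul_eq_mul, mul_comm]
      _ ≤ ∑ a ∈ I, coverW cert a := sum_le_sum fun a ha => hcov a (hI81 a ha)
  have h2 : (cert.map fun cw => cw.2 * #(I.filter (· ∈ cw.1))).sum ≤ (cert.map (·.2)).sum :=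
    List.sum_le_sum fun cw hcw =>
      calc cw.2 * #(I.filter (· ∈ cw.1)) ≤ cw.2 * 1 := Nat.mul_le_mul_left _ (card_filter_mem_le_one hI cw.1 (hcl cw hcw))
        _ = cw.2 := mul_one _
  rw [sum_coverW] at h1
  have hM : M * #I < 17 * M := lt_of_le_of_lt (h1.trans h2) hsum
  rw [mul_comm 17] at hM
  exact Nat.lt_of_mul_lt_mul_left hM

/-- The nine lift translates of each base clique (the certificate files list base cliques only). [folklore] -/
def expandT (base : List (List ℕ × ℕ)) : List (List ℕ × ℕ) :=
  base.flatMap fun cw => (List.range 9).map fun s => (cw.1.map (transl (s % 3) (s / 3)), cw.2)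

/-- **Translated weighted clique cover** of configuration `n` (base cliques, weights, multiplicity `M`). [folklore] -/
theorem bound16_of_wcOKT {n : ℕ} {base : List (List ℕ × ℕ)} {M : ℕ} (h : wcOK n (expandT base) M = true) : Bound16 n :=
  bound16_of_wcOK h

end Summit.MatrixMultiplication.OmegaCensus.DihC3Sq
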